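import Literature.Analysis.FluidPDE.FluidComputer.ThresholdLevelTableU
import HarnessLib

/-!
# Kernel run of the re-cut table over the 10⁻² box, chunks 44 … 47 (bp3 gen 13, layer 4: robustness variant U)

HONEST FRAMING: low prior, high value-of-information experiment on Tao's machine paradigm; NOT a
claim that NS blows up.

Four kernel evaluations (`decide +kernel`; no `native_decide`, no extra axioms) of the checker
`runSteps` (`ThresholdLevelCheck.lean`) with the interval gate data `GIu` (all seven data within
relative `10⁻²`) on ≤ 25 steps of `ThresholdLevelTableU.stepsU` at a time, from `Bu i` towards the next chunk's
first level, returning `Bu (i+1)` (`Bu 0 = ThresholdLevelTable.Bc0`).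
-/

namespace Literature.Analysis.FluidPDE.FluidComputer

namespace ThresholdLevelTableU

open ThresholdLevelTable (Bc0 RbIt)

set_option maxHeartbeats 10000000 in
set_option maxRecDepth 200000 in
/-- Chunk 44 of the re-cut table run over the 10⁻² box (steps 1100 … 1124). [folklore] -/
theorem runU44 : runSteps 60 12 3 GIu RbIt Bu44 chunkU44 23655675970191464 = some Bu45 := by
  decide +kernel

set_option maxHeartbeats 10000000 in
set_option maxRecDepth 200000 in
/-- Chunk 45 of the re-cut table run over the 10⁻² box (steps 1125 … 1149). [folklore] -/
theorem runU45 : runSteps 60 12 3 GIu RbIt Bu45 chunkU45 25806914889368432 = some Bu46 := by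
  decide +kernel

set_option maxHeartbeats 10000000 in
set_option maxRecDepth 200000 in
/-- Chunk 46 of the re-cut table run over the 10⁻² box (steps 1150 … 1174). [folklore] -/
theorem runU46 : runSteps 60 12 3 GIu RbIt Bu46 chunkU46 28154128036621678 = some Bu47 := by
  decide +kernel

set_option maxHeartbeats 10000000 in
set_option maxRecDepth 200000 in
/-- Chunk 47 of the re-cut table run over the 10⁻² box (steps 1175 … 1199). [folklore] -/
theorem runU47 : runSteps 60 12 3 GIu RbIt Bu47 chunkU47 30714454617193348 = some Bu48 := by
  decide +kernel

end ThresholdLevelTableU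

end Literature.Analysis.FluidPDE.FluidComputer
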